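import Summits.QuantumFields.QCD.Theorems.HeatSlicedQuarksQuarkLoopCoefficientHeatSeriesB
import Summits.QuantumFields.QCD.Theorems.HeatSlicedQuarksQuarkLoopCoefficientFreeHeatCalculusAuxC
import Summits.QuantumFields.QCD.Theorems.HeatSlicedQuarksQuarkLoopCoefficientFreeHeatCalculusAuxF

/-!
# Free heat calculus on `ℤ⁴` (stub `stub_freeHeatCalculus` of the line `Sketch`, crux stmt-QuantumFields-16786)

The structural identities of the free kernel `k_t = freeKer t` needed by the line, assembled from the helper
files `…FreeHeatCalculusAux` – `…AuxF`:

1. the free `D♯D` kernel is scalar in spin, `sqKer 1 x y = ĥ(y − x) • 1` (part C);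
2. the exponential-series heat kernel of the trivial link field is the Brillouin-zone kernel,
   `heatKer 1 t x y = k_t(y − x) • 1` for `t ≥ 0` (this file: both sides solve, entrywise and as functions
   of `x`, the lattice heat equation `∂_t X(x) = −Σ_v ĥ(v) X(x − v)` with the same initial value and are
   bounded on compact time intervals; uniqueness, part E);
3. `k_0 = δ₀` (part D);
4. the lattice heat equation `∂_t k_t(w) = −Σ_{z ∈ nbr2 0} ĥ(z) k_t(w − z)` (part D);
5. the semigroup law (part F, from the Gaussian majorant and the mass bound of the toolkit);
6. the first-order integration-by-parts identity (part E, from the Gaussian majorant and the moment bound);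
7. evenness (part D).
-/

noncomputable section

namespace Summit.QuantumFields.QCD.Cruxes.QuarkLoopCoefficient.Sketch.FreeHeatCalculus

open Literature.MathematicalPhysics.QuantumLattice Literature.MathematicalPhysics.QuantumFieldTheory
open Literature.Probability.LatticeModels (Site TorusSite)
open Summit.QuantumFields.QCD.Theorems.QuarkLoopCoefficient
open Summit.QuantumFields.QCD.Cruxes.QuarkLoopCoefficient.Sketch.HeatSeries
open MeasureTheory
open scoped Matrix ComplexConjugate

/-! ## Conjunct (2): the series kernel of the trivial link field is the Brillouin-zone kernel -/

/-- The trivial link field is (sub-)unimodular. -/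
theorem norm_trivialLink_le : ∀ e : ZdEdge 4, ‖(fun _ => (1 : ℂ) : LGConfig 4 ℂ) e‖ ≤ 1 := fun _ => by
  simp

/-- The stencil of the series side: `(Σ_{z ∈ nbr2 x} H(x,z) K(z))_{αβ} = Σ_{v ∈ nbr2 0} ĥ(v) K(x − v)_{αβ}`
for the free squared kernel `H = ĥ • 1`. -/
theorem free_stencil_apply (K : Site 4 → Spin) (x : Site 4) (α β : Fin 4) :
    (∑ z ∈ nbr2 x, sqKer (fun _ => (1 : ℂ)) x z * K z) α β =
      ∑ v ∈ nbr2 0, ((hhat v : ℝ) : ℂ) * K (x - v) α β := by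
  rw [Matrix.sum_apply, sum_nbr2_translate x, ← sum_nbr2_neg]
  refine Finset.sum_congr rfl fun v _ => ?_
  rw [sqKer_one, Matrix.smul_mul, Matrix.one_mul, Matrix.smul_apply, smul_eq_mul,
    show x + -v - x = -v by abel, hhat_neg, ← sub_eq_add_neg]

/-- The stencil of the integral side: `Σ_{z ∈ nbr2 0} ĥ(z) k_t(y − x − z) = Σ_{v ∈ nbr2 0} ĥ(v) k_t(y − (x − v))`. -/
theorem free_stencil_freeKer (t : ℝ) (x y : Site 4) :
    ∑ z ∈ nbr2 0, hhat z * freeKer t (y - x - z) = ∑ v ∈ nbr2 0, hhat v * freeKer t (y - (x - v)) := by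
  rw [← sum_nbr2_neg]
  refine Finset.sum_congr rfl fun v _ => ?_
  rw [hhat_neg, show y - x - -v = y - (x - v) by abel]

/-- **Conjunct (2)**: `heatKer 1 t x y = k_t(y − x) • 1` for `t ≥ 0`, entrywise by uniqueness for the
lattice heat equation in the variable `x`. -/
theorem heatKer_one_eq :
    ∀ t : ℝ, 0 ≤ t → ∀ x y : Site 4,
      heatKer (fun _ => (1 : ℂ)) t x y = ((freeKer t (y - x) : ℝ) : ℂ) • (1 : Spin) := by
  have hu := norm_trivialLink_le
  intro T hT x₀ y
  ext α β
  rw [Matrix.smul_apply, smul_eq_mul]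
  -- the difference of the two candidate solutions, as a function of time and of the row index `x`
  set X : ℝ → Site 4 → ℂ := fun t x =>
    heatKer (fun _ => (1 : ℂ)) t x y α β - ((freeKer t (y - x) : ℝ) : ℂ) * (1 : Spin) α β with hX
  have h0 : ∀ x : Site 4, X 0 x = 0 := by
    intro x
    simp only [hX, heatKer_zero hu, freeKer_zero]
    by_cases hxy : x = y
    · subst hxy
      simp
    · have hyx : y - x ≠ 0 := sub_ne_zero.mpr (Ne.symm hxy)
      simp [hxy, hyx]
  have hbound : ∀ t ∈ Set.Icc 0 T, ∀ x : Site 4, ‖X t x‖ ≤ Real.exp (1679616 * T) + 1 := by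
    intro t ht x
    refine (norm_sub_le _ _).trans (add_le_add ?_ ?_)
    · refine (norm_heatKer_apply_le hu t x y α β).trans (Real.exp_le_exp.mpr ?_)
      rw [abs_of_nonneg ht.1]
      nlinarith [ht.2]
    · rw [norm_mul, Complex.norm_real, Real.norm_eq_abs]
      have h1 : ‖(1 : Spin) α β‖ ≤ 1 := by
        rw [Matrix.one_apply]; split_ifs <;> simp
      calc |freeKer t (y - x)| * ‖(1 : Spin) α β‖ ≤ 1 * 1 :=
            mul_le_mul (abs_freeKer_le_one ht.1 _) h1 (norm_nonneg _) zero_le_one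
        _ = 1 := one_mul 1
  have hderiv : ∀ t ∈ Set.Icc 0 T, ∀ x : Site 4,
      HasDerivAt (fun s => X s x) (-(∑ v ∈ nbr2 0, hhat v • X t (x - v))) t := by
    intro t _ x
    have hA := hasDerivAt_heatKer_apply hu t x y α β
    have hB : HasDerivAt (fun s : ℝ => ((freeKer s (y - x) : ℝ) : ℂ) * (1 : Spin) α β)
        ((((-(∑ z ∈ nbr2 0, hhat z * freeKer t (y - x - z)) : ℝ)) : ℂ) * (1 : Spin) α β) t :=
      (hasDerivAt_freeKer t (y - x)).ofReal_comp.mul_const _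
    refine (hA.sub hB).congr_deriv ?_
    rw [free_stencil_apply, free_stencil_freeKer]
    push_cast
    simp only [hX, Complex.real_smul, mul_sub, Finset.sum_sub_distrib, neg_mul, Finset.sum_mul, mul_assoc]
    ring
  have hzero := lattice_heat_unique hderiv hbound h0 T ⟨hT, le_rfl⟩ x₀
  simpa only [hX, sub_eq_zero] using hzero

/-! ## The registered stub -/

/-- **Stub `stub_freeHeatCalculus`** of the line `Sketch` of crux stmt-QuantumFields-16786:
`FreeMajorantToolkit → FreeHeatCalculus`, stated expanded (registered text).  The toolkit supplies the
decay needed for summability and boundedness in the uniqueness arguments of conjuncts (5) and (6). -/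
theorem stub_freeHeatCalculus :
    ((∃ C c : ℝ, 0 < c ∧ ∀ t : ℝ, 0 ≤ t → ∀ w : Site 4, |freeKer t w| ≤ C * gaussProfile c t w) ∧
      (∀ c ε : ℝ, 0 < c → 0 < ε → ε < 1 → ∃ B : ℝ, ∀ a b : ℝ, 0 ≤ a → 0 ≤ b → ∀ w : Site 4,
        Summable (fun y : Site 4 => gaussProfile ((1 - ε) * c) a y * gaussProfile c b (w - y)) ∧
        ∑' y : Site 4, gaussProfile ((1 - ε) * c) a y * gaussProfile c b (w - y) ≤
          B * gaussProfile ((1 - ε) * c) (a + b) w) ∧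
      (∀ c ε : ℝ, 0 < c → 0 < ε → ε < 1 → ∀ j : ℕ, ∃ A : ℝ, ∀ t : ℝ, 0 ≤ t → ∀ w : Site 4,
        elen w ^ j * gaussProfile c t w ≤ A * Real.sqrt (1 + t) ^ j * gaussProfile ((1 - ε) * c) t w) ∧
      (∀ c ε : ℝ, 0 < c → 0 < ε → ε < 1 → ∃ A : ℝ, ∀ t : ℝ, 0 ≤ t → ∀ w z : Site 4, elen z ≤ 2 →
        gaussProfile c t (w + z) ≤ A * gaussProfile ((1 - ε) * c) t w) ∧
      (∀ c : ℝ, 0 < c → ∃ A : ℝ, ∀ t : ℝ, 0 ≤ t →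
        Summable (fun y : Site 4 => gaussProfile c t y) ∧ ∑' y : Site 4, gaussProfile c t y ≤ A) ∧
      (∀ c : ℝ, 0 < c → ∃ C : ℝ, ∀ (L : ℕ), 1 ≤ L → ∀ t : ℝ, 1 ≤ t → t ≤ (L : ℝ) ^ 2 →
        Summable (fun n : Site 4 => gaussProfile c t (fun μ => (L : ℤ) * n μ)) ∧
        ∑' n : Site 4, (if n = 0 then 0 else gaussProfile c t (fun μ => (L : ℤ) * n μ)) ≤
          C * Real.exp (-(c / 2 * (L : ℝ) ^ 2 / (t + (L : ℝ)))) / t ^ 2)) →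
    ((∀ x y : Site 4, sqKer (fun _ => (1 : ℂ)) x y = ((hhat (y - x) : ℝ) : ℂ) • (1 : Spin)) ∧
      (∀ t : ℝ, 0 ≤ t → ∀ x y : Site 4,
        heatKer (fun _ => (1 : ℂ)) t x y = ((freeKer t (y - x) : ℝ) : ℂ) • (1 : Spin)) ∧
      (∀ w : Site 4, freeKer 0 w = if w = 0 then 1 else 0) ∧
      (∀ (t : ℝ) (w : Site 4),
        HasDerivAt (fun s => freeKer s w) (-(∑ z ∈ nbr2 0, hhat z * freeKer t (w - z))) t) ∧
      (∀ s r : ℝ, 0 ≤ s → 0 ≤ r → ∀ w : Site 4,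
        HasSum (fun y : Site 4 => freeKer s y * freeKer r (w - y)) (freeKer (s + r) w)) ∧
      (∀ t : ℝ, 0 ≤ t → ∀ (w : Site 4) (ν : Fin 4),
        t * (∑ z ∈ nbr2 0, ((z ν : ℤ) : ℝ) * hhat z * freeKer t (w - z)) + ((w ν : ℤ) : ℝ) * freeKer t w = 0) ∧
      (∀ (t : ℝ) (w : Site 4), freeKer t (-w) = freeKer t w)) := by
  rintro ⟨hgauss, -, hmom, -, hmass, -⟩
  exact ⟨sqKer_one, heatKer_one_eq, freeKer_zero, hasDerivAt_freeKer, semigroup_identity hgauss hmass,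
    ibp_identity hgauss hmom, freeKer_neg⟩

end Summit.QuantumFields.QCD.Cruxes.QuarkLoopCoefficient.Sketch.FreeHeatCalculus

end
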